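import Literature.NumberTheory.LFunctions.RHClassicalEquivalentsSpeiserProofs
import Literature.NumberTheory.LFunctions.RiemannHypothesisUpTo101
import HarnessLib

/-!
# Spira's table `ζ'(s) ≠ 0` (`0 < σ < ½`, `0 < |t| ≤ 100`) — discharge of `spira1965_deriv_riemannZeta_ne_zero`

Trunk T-ANT (`NumberTheory/LFunctions`). Companion ("Proofs") file of
`Literature/NumberTheory/LFunctions/LevinsonMontgomeryTheorem.lean` for its named fact
`Literature.NumberTheory.LFunctions.spira1965_deriv_riemannZeta_ne_zero`: "`ζ'(s) ≠ 0` for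
`0 < σ < ½`, `0 < |t| ≤ 200` (although only the region `|t| ≤ 100` was reported on)" — R. Spira,
*Zeros of `ζ'(s)` and the Riemann hypothesis*, Illinois J. Math. 17 (1973), p. 149, quoting the
computation of R. Spira, *Zero-free regions of `ζ^{(k)}(s)`*, J. London Math. Soc. 40 (1965),
677–682 — vendored in the reported range `|t| ≤ 100`. Spira's value table is not reproduced: the
statement is *proved* from results of the tree, along the lines of Spira's own §2 ("by the theorem
of Levinson and Montgomery the zeros of `ζ'` in `0 < σ < ½` correspond to zeros of `ζ` off the
line"):

* **`0 < |t| ≤ 10`**: the kernel-checked low-height certificates of the Levinson–Montgomery route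
  (`Literature.NumberTheory.LFunctions.deriv_riemannZeta_ne_zero_lowHeight`,
  `RHClassicalEquivalentsSpeiserProofs.lean`: `ζ' ≠ 0` on `(0, ½) × (0, 10]`, Euler–Maclaurin
  enclosures and winding certificates), and conjugation `ζ'(s̄) = conj ζ'(s)`
  (`Literature.NumberTheory.LFunctions.deriv_riemannZeta_conj`) for `t < 0`;
* **`10 ≤ |t| ≤ 100`**: Levinson–Montgomery's sign theorem at *good* heights
  (`Literature.NumberTheory.LFunctions.re_logDeriv_riemannZeta_neg_of_lmGood'`,
  `LevinsonMontgomeryTheorem.lean`: `Re ζ'/ζ(σ + it) < 0` for `0 ≤ σ < ½`, `|t| ≥ 10`, `t` good),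
  every `|t| ≤ 100.5` being good because **the Riemann hypothesis holds up to height `101`**
  (`Literature.NumberTheory.LFunctions.riemannHypothesisInStripUpTo_hundredOne`,
  `RiemannHypothesisUpTo101.lean`: kernel-checked Backlund certificate, `N(101) = N₀(101) = 29`):
  a zero of `ζ` off the critical line has `|γ| > 101`, hence distance `> ½` from such `t`
  (`lmGood_of_riemannHypothesisInStripUpTo`).

## Main results (namespace `Literature.NumberTheory.LFunctions`, all proved)

* `lmGood_of_riemannHypothesisInStripUpTo` — RH in the strip up to `T'` makes every
  `|t| ≤ T' − ½` a good height; `lmGood_of_abs_le` — every `|t| ≤ 201/2` is good.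
* `deriv_riemannZeta_ne_zero_of_abs_im` — `ζ'(s) ≠ 0` for `0 ≤ Re s < ½`, `10 ≤ |Im s| ≤ 201/2`.
* `spira1965_deriv_riemannZeta_ne_zero_holds` — **the discharge**.

All depend only on the axioms `propext`, `Classical.choice`, `Quot.sound`.

## References

* R. Spira, *Zeros of `ζ'(s)` and the Riemann hypothesis*, Illinois J. Math. 17 (1973), 147–152,
  p. 149. [Spira1973]
* N. Levinson, H. L. Montgomery, *Zeros of the derivatives of the Riemann zeta-function*, Acta
  Math. 133 (1974), 49–65, §2. [LevinsonMontgomery1974]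
-/

noncomputable section

open Complex
open scoped Real ComplexConjugate

namespace Literature.NumberTheory.LFunctions

/-- **Good heights from RH in a strip.** If every zero of `ζ` with `0 < Re ρ < 1`, `|Im ρ| ≤ T'`
lies on the critical line, then every `t` with `|t| ≤ T' − ½` is a good height in the sense of
Levinson–Montgomery (`Literature.NumberTheory.LFunctions.lmGood`: distance `≥ ½` from the
ordinate of every zero off the line). [cite: LevinsonMontgomery1974, §2] -/
theorem lmGood_of_riemannHypothesisInStripUpTo {T' t : ℝ} (h : RiemannHypothesisInStripUpTo T')
    (ht : |t| ≤ T' - 1 / 2) : lmGood t := by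
  intro ρ h0 h1 h2 h3
  have hgt : T' < |ρ.im| := by
    by_contra hle
    push Not at hle
    exact h3 (h ρ h0 h1 h2 hle)
  have htri : |ρ.im| - |t| ≤ |t - ρ.im| := by
    rw [abs_sub_comm t ρ.im]
    exact abs_sub_abs_le_abs_sub ρ.im t
  linarith

/-- Every height `|t| ≤ 201/2` is good (RH up to height `101`,
`Literature.NumberTheory.LFunctions.riemannHypothesisInStripUpTo_hundredOne`). [folklore] -/
theorem lmGood_of_abs_le {t : ℝ} (ht : |t| ≤ 201 / 2) : lmGood t :=
  lmGood_of_riemannHypothesisInStripUpTo riemannHypothesisInStripUpTo_hundredOne (by linarith)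

/-- **`ζ'(s) ≠ 0` for `0 ≤ Re s < ½`, `10 ≤ |Im s| ≤ 201/2`**: Levinson–Montgomery's sign theorem
`Re ζ'/ζ(s) < 0` at good heights (`re_logDeriv_riemannZeta_neg_of_lmGood'`) and
`lmGood_of_abs_le`. [cite: LevinsonMontgomery1974, §2] -/
theorem deriv_riemannZeta_ne_zero_of_abs_im {s : ℂ} (h0 : 0 ≤ s.re) (h1 : s.re < 1 / 2)
    (ht : 10 ≤ |s.im|) (hT : |s.im| ≤ 201 / 2) : deriv riemannZeta s ≠ 0 :=
  (ne_zero_of_re_logDeriv_neg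
    (re_logDeriv_riemannZeta_neg_of_lmGood' (lmGood_of_abs_le hT) ht h0 h1)).2

/-- **Discharge of `spira1965_deriv_riemannZeta_ne_zero`**: `ζ'(s) ≠ 0` for `0 < Re s < ½`,
`0 < |Im s| ≤ 100` (Spira, Illinois J. Math. 17 (1973), p. 149: "`ζ'(s) ≠ 0` for `0 < σ < ½`,
`0 < |t| ≤ 200`, although only the region `|t| ≤ 100` was reported on"). Heights `|t| ≤ 10` by
the certified low-height computation `deriv_riemannZeta_ne_zero_lowHeight` (and conjugation for
`t < 0`), heights `10 ≤ |t| ≤ 100` by `deriv_riemannZeta_ne_zero_of_abs_im`.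
[cite: Spira1973, p. 149] -/
theorem spira1965_deriv_riemannZeta_ne_zero_holds : spira1965_deriv_riemannZeta_ne_zero := by
  intro s h0 h1 ht hT
  rcases le_or_gt 10 |s.im| with h10 | h10
  · exact deriv_riemannZeta_ne_zero_of_abs_im h0.le h1 h10 (by linarith)
  · rcases lt_or_gt_of_ne (abs_pos.1 ht) with hneg | hpos
    · -- `Im s < 0`: pass to the conjugate
      have habs : |s.im| = -s.im := abs_of_neg hneg
      have hre : (conj s).re = s.re := Complex.conj_re s
      have him : (conj s).im = -s.im := Complex.conj_im s
      have hc : deriv riemannZeta (conj s) ≠ 0 :=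
        deriv_riemannZeta_ne_zero_lowHeight (conj s) (by rw [hre]; exact h0) (by rw [hre]; exact h1)
          (by rw [him]; linarith) (by rw [him]; linarith)
      intro hz
      apply hc
      rw [deriv_riemannZeta_conj, hz, map_zero]
    · have : |s.im| = s.im := abs_of_pos hpos
      exact deriv_riemannZeta_ne_zero_lowHeight s h0 h1 hpos (by linarith)

end Literature.NumberTheory.LFunctions

end
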